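import Mathlib
import HarnessLib
import Literature.Probability.LatticeModels.ChessboardEstimateObservables
import Summits.QuantumFields.YangMills.Theorems.LangevinControlUVFemtoCurvatureTwoPointStubPlaquetteProductRPCSHelpers

/-!
# The chessboard estimate for Wilson's lattice gauge measure on an even torus, all axes
# (helper for support `ChessboardTransfer`, stmt-QuantumFields-23370, route `DyadicChessboard`)

Route-independent helper (imports Literature + the route-independent RP helpers only; no definitions).  It packages
the tree's reflection-positivity engine for Wilson's torus measure `μ_β = wilsonMeasure ρ β` on `(ℤ/L)^d`, `L` even,
`β ≥ 0` — the transported link reflections `Θ_{π,v} = τ_v ∘ π_* ∘ Θ₀ ∘ π_*⁻¹ ∘ τ_{−v}`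
(`FiniteSusceptibilityWeakCoupling.RPCauchySchwarz.theta_theta / measurable_theta / map_theta`) and their
positivity `0 ≤ ∫ F(ΘU) F(U) dμ_β` for bounded measurable `F` depending only on the links whose pull-back is a
positive-time link (`FemtoCurvatureTwoPoint.PlaquetteProductRPCS.integral_linkTheta_mul_nonneg`) — into the three
hypotheses (measure-preserving involutions, sub-σ-algebras `𝓕₊`, reflection positivity) of the Literature
observable-form chessboard estimate `Literature.Probability.LatticeModels.chessboard_integral_prod_subset_le`
(FILS 1978 Thm 4.1 / Friedli–Velenik Thm 10.11), with `𝓕₊ = MeasurableSpace.comap` of the restriction to the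
admissible links:

* `measurable_comap_restrict_of_dependsOn` / `dependsOn_of_measurable_comap_restrict` — on a product of groups,
  "depends only on the coordinates in `S`" (+ measurable) ⟺ measurable w.r.t. `comap (restriction to S)`;
* `wilson_rp_comap` — reflection positivity of `μ_β` in `comap` form for every transported link reflection;
* ★ `wilson_chessboard_integral_prod_subset_le` — for ANY families of axis permutations `π i` and shifts
  `v i k` (the user picks `π i = swap 0 i`, `v i k = (k·n − 1)·e_i` for cells of side `n`, `N·n = L`), every
  bounded measurable COHERENT REFLECTED ARRAY `g a c` of cell observables (`g a (cellReflect i k c) = g a c ∘ Θ_{π i, v i k}`)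
  depending, for `c ∈ halfPlus N i k`, only on links whose pull-back by `τ_{v i k} ∘ (π i)_*` is positive-time,
  obeys `|∫ ∏_{c ∈ S} g (lab c) c dμ_β| ≤ ∏_{c ∈ S} (∫ ∏_{c'} g (lab c) c' dμ_β) ^ (1/N^d)`.

What the `ChessboardTransfer` prover still supplies: the coherent array of reflected centred plaquettes matching
K1's `site` formula, its localisation, the offset pigeonhole, and K1's array bound.  Cell `ym-idea-1` width seat
`ym-line-sfw-p2-w3` g29 (free hands).  HONEST FRAMING: helper only; no crux, rung or summit is proved; the YM mass
gap is NOT proved.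
-/

set_option autoImplicit false

noncomputable section

namespace Summit.QuantumFields.YangMills.Theorems.DyadicChessboard.WilsonChessboardRP

open MeasureTheory
open Literature.MathematicalPhysics.QuantumFieldTheory
open Literature.Barriers.CriticalPhenomena.NonGibbs (BlockIdx cellReflect halfPlus)
open Summit.QuantumFields.YangMills.Theorems.FiniteSusceptibilityWeakCoupling.RPCauchySchwarz
  (theta_theta measurable_theta map_theta)
open Summit.QuantumFields.YangMills.Theorems.FemtoCurvatureTwoPoint.PlaquetteProductRPCS
  (integral_linkTheta_mul_nonneg)

/-! ## Dependence on a set of links ⟺ measurability for the restriction σ-algebra -/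

section Comap

variable {E G : Type*} [MeasurableSpace G]

/-- A function on `E → G` that is measurable for `comap (restriction to S)` depends only on the coordinates in
`S` (the preimage of the singleton `{F U}` is the preimage of a set of restrictions). [folklore] -/
theorem dependsOn_of_measurable_comap_restrict (S : Set E) {F : (E → G) → ℝ}
    (hF : Measurable[MeasurableSpace.comap (fun (U : E → G) (e : S) => U e.1) MeasurableSpace.pi] F) :
    DependsOn F S := by
  intro U V hUV
  have hres : (fun e : S => U e.1) = fun e : S => V e.1 := funext fun e => hUV e.1 e.2
  have hmeas : MeasurableSet[MeasurableSpace.comap (fun (U : E → G) (e : S) => U e.1) MeasurableSpace.pi]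
      (F ⁻¹' {F U}) := hF (measurableSet_singleton _)
  rcases hmeas with ⟨B, -, hB⟩
  have hU : U ∈ F ⁻¹' {F U} := rfl
  rw [← hB] at hU
  have hV : V ∈ (fun (W : E → G) (e : S) => W e.1) ⁻¹' B := by
    rw [Set.mem_preimage] at hU ⊢; rwa [← hres]
  rw [hB] at hV
  exact hV.symm

variable [Group G]

/-- Conversely, a measurable function depending only on the coordinates in `S` is measurable for
`comap (restriction to S)`: it factors through the restriction via the extension by `1` off `S`. [folklore] -/
theorem measurable_comap_restrict_of_dependsOn (S : Set E) {F : (E → G) → ℝ} (hFm : Measurable F)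
    (hF : DependsOn F S) :
    Measurable[MeasurableSpace.comap (fun (U : E → G) (e : S) => U e.1) MeasurableSpace.pi] F := by
  classical
  -- extension of a restricted configuration by `1`
  let ext : (S → G) → (E → G) := fun s e => if h : e ∈ S then s ⟨e, h⟩ else 1
  have hext : Measurable ext := by
    refine measurable_pi_lambda _ fun e => ?_
    by_cases h : e ∈ S
    · simp only [ext, h, dif_pos]; exact measurable_pi_apply _
    · simp only [ext, h, dif_neg, not_false_eq_true]; exact measurable_const
  have hfac : F = (F ∘ ext) ∘ fun (U : E → G) (e : S) => U e.1 := by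
    funext U
    refine hF fun e he => ?_
    simp [ext, he]
  rw [hfac]
  exact (hFm.comp hext).comp (measurable_iff_comap_le.2 le_rfl)

end Comap

/-! ## Reflection positivity of the Wilson measure in `comap` form, all transported link reflections -/

section Wilson

variable {d L Nr : ℕ} [NeZero d] [NeZero L] {G : Type} [Group G] [TopologicalSpace G] [IsTopologicalGroup G]
  [CompactSpace G] [MeasurableSpace G] [BorelSpace G] (ρ : G →* Matrix (Fin Nr) (Fin Nr) ℂ)

/-- **Reflection positivity of `μ_β` in `comap` form**: for the transported link reflection `Θ_{π,v}` (`L` even,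
`β ≥ 0`) and every bounded `F` measurable for the restriction σ-algebra of the links whose pull-back by
`τ_v ∘ π_*` is positive-time, `0 ≤ ∫ F(U) · F(Θ_{π,v} U) dμ_β`. [folklore] -/
theorem wilson_rp_comap (hL : Even L) (hρ : Continuous ρ) {β : ℝ} (hβ : 0 ≤ β) (π : Equiv.Perm (Fin d))
    (v : Site d L) (F : GaugeConfig d L G → ℝ)
    (hF : Measurable[MeasurableSpace.comap (fun (U : GaugeConfig d L G)
      (e : {e : Edge d L | WilsonRP.IsPosEdge ((sitePerm π.symm (e.1 - v), π.symm e.2) : Edge d L)}) => U e.1)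
      MeasurableSpace.pi] F)
    (hFb : ∃ C : ℝ, ∀ U, |F U| ≤ C) :
    0 ≤ ∫ U, F U * F (torusConfigShift v (configPerm π (GaugeConfig.timeReflect (configPerm π.symm
      (torusConfigShift (-v) U))))) ∂(wilsonMeasure (d := d) (L := L) ρ β) := by
  have hle : MeasurableSpace.comap (fun (U : GaugeConfig d L G)
      (e : {e : Edge d L | WilsonRP.IsPosEdge ((sitePerm π.symm (e.1 - v), π.symm e.2) : Edge d L)}) => U e.1)
      MeasurableSpace.pi ≤ (inferInstance : MeasurableSpace (GaugeConfig d L G)) :=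
    (measurable_pi_lambda _ fun e => measurable_pi_apply _).comap_le
  have hFm : Measurable F := hF.mono hle le_rfl
  have hdep := dependsOn_of_measurable_comap_restrict _ hF
  have h := integral_linkTheta_mul_nonneg ρ hL hρ hβ π v F hFm hFb hdep
  refine h.trans_eq (integral_congr_ae (Filter.Eventually.of_forall fun U => ?_))
  simp only [mul_comm]

/-- **The chessboard estimate for the Wilson measure on an even torus, all axes** (FILS 1978 Thm 4.1/4.3 via the
Literature observable form + the tree's transported link reflection positivity).  `L` even, `β ≥ 0`, `N` even
(`N` cells per axis), any axis permutations `π i` and shifts `v i k`; `g a c` bounded measurable cell observables,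
coherent (`g a (cellReflect i k c) = g a c ∘ Θ_{π i, v i k}`) and, for `c ∈ halfPlus N i k`, depending only on links
whose pull-back by `τ_{v i k} ∘ (π i)_*` is positive-time.  Then for every set of cells `S` and labels `lab`,
`|∫ ∏_{c ∈ S} g (lab c) c dμ_β| ≤ ∏_{c ∈ S} (∫ ∏_{c'} g (lab c) c' dμ_β) ^ (1/N^d)`.
[cite: FrohlichIsraelLiebSimon1978, Thm 4.3] -/
theorem wilson_chessboard_integral_prod_subset_le (hd : 0 < d) (hL : Even L) (hρ : Continuous ρ) {β : ℝ}
    (hβ : 0 ≤ β) {N : ℕ} [NeZero N] (hN : Even N) (π : Fin d → Equiv.Perm (Fin d))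
    (v : Fin d → ZMod N → Site d L) {ι : Type*} (g : ι → BlockIdx d N → GaugeConfig d L G → ℝ)
    (hgm : ∀ a c, Measurable (g a c)) (hgb : ∀ a c, ∃ C : ℝ, ∀ U, |g a c U| ≤ C)
    (hgdep : ∀ a c (i : Fin d) (k : ZMod N), c ∈ halfPlus N i k → DependsOn (g a c)
      {e : Edge d L | WilsonRP.IsPosEdge ((sitePerm (π i).symm (e.1 - v i k), (π i).symm e.2) : Edge d L)})
    (hgΘ : ∀ a (i : Fin d) (k : ZMod N) c U, g a (cellReflect i k c) U =
      g a c (torusConfigShift (v i k) (configPerm (π i) (GaugeConfig.timeReflect (configPerm (π i).symm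
        (torusConfigShift (-(v i k)) U))))))
    (S : Finset (BlockIdx d N)) (lab : BlockIdx d N → ι) :
    |∫ U, ∏ c ∈ S, g (lab c) c U ∂(wilsonMeasure (d := d) (L := L) ρ β)| ≤
      ∏ c ∈ S, (∫ U, ∏ c', g (lab c) c' U ∂(wilsonMeasure (d := d) (L := L) ρ β)) ^ ((1 : ℝ) / (N : ℝ) ^ d) := by
  haveI := isProbabilityMeasure_wilsonMeasure (d := d) (L := L) (G := G) ρ hρ β
  refine Literature.Probability.LatticeModels.chessboard_integral_prod_subset_le
    (wilsonMeasure (d := d) (L := L) ρ β) hd hN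
    (fun i k U => torusConfigShift (v i k) (configPerm (π i) (GaugeConfig.timeReflect (configPerm (π i).symm
        (torusConfigShift (-(v i k)) U)))))
    (fun i k => ⟨measurable_theta (π i) (v i k), map_theta ρ hρ β (π i) (v i k)⟩)
    (fun i k U => theta_theta (π i) (v i k) U)
    (fun i k => MeasurableSpace.comap (fun (U : GaugeConfig d L G)
      (e : {e : Edge d L | WilsonRP.IsPosEdge ((sitePerm (π i).symm (e.1 - v i k), (π i).symm e.2) : Edge d L)})
        => U e.1) MeasurableSpace.pi)
    (fun i k => (measurable_pi_lambda _ fun e => measurable_pi_apply _).comap_le)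
    (fun i k F hF hFb => wilson_rp_comap ρ hL hρ hβ (π i) (v i k) F hF hFb)
    g hgb (fun a c i k hc => measurable_comap_restrict_of_dependsOn _ (hgm a c) (hgdep a c i k hc)) hgΘ S lab

end Wilson

end Summit.QuantumFields.YangMills.Theorems.DyadicChessboard.WilsonChessboardRP

end
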